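import Mathlib
import Summits.QuantumFields.YangMills.Theses.CoarseStiffnessTail
import Summits.QuantumFields.YangMills.Theorems.CoarseStiffnessTailCappedCoarseStiffnessLUnitPolyTailOfChi

/-!
# Route `CoarseStiffnessTail` (rev 1 «unit-poly-tail») — crux `UnitPolyTailL` (stmt-QuantumFields-24027), LINE 20: BOTH STANDING SUPPLIERS
# DELIVER THE ORGAN STUB `stub_topTailDegraded` IN ITS REGISTERED FORMAT (rev 0's crux `CappedCoarseStiffnessL`; the χ-lane's single stub
# `AlphaInputsT3ACv4RecChi`) — the organ is no stronger than what either supplier proves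

Prover seat `ym-line-cst-p1` (g23).  The LINE-20 skeleton `Cruxes/HistoryTailL/Lines/unit_poly_tail.lean` (ideator `ym-r3-idea-2` g10) has ONE
open stub after `stub_absorbRate` landed (`CoarseStiffnessTailUnitPolyTailLAbsorbRate`, ✓): the ORGAN

  TopTailDegraded := `∀ L b₁ p₁ ∃ (b₀, p₀) ≥ (b₁, p₁) (0 < b₀, 2 < p₀) ∃ c > 0, κ ≥ 0, q < 2p₀, A, C ≥ 0, γ₁ ∈ (0, 1] ∀ F (F.L = L) ∀ γ ∈ (0, γ₁] ∀ K a :`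
                     `Gibbs_K{θ_γ(0) ≤ |Ū^K(∂a) − 1|} ≤ C·γ^(−A)·exp(−c·p(√γ)² + κ·(1 + log(√γ)⁻¹)^q)`

(written out verbatim in every theorem below; no definition is introduced).  This file records, as kernel facts, that the organ's FORMAT receives
both existing suppliers of the route — so the stub is correctly typed (a TRANSFER check for the line, not progress on the organ itself):

* §1 `topTailDegraded_of_unitLargeFieldCountLog` — S1_log (the unit-scale large-field COUNT bound with logarithmic slack, g21) ⇒ organ with
  `κ = 0`, `q = 0`, `A = 9000·L³·A_log`, `C = e^{9000L³|C₀|}`, `c = c₀`: the top-slice chessboard `perPlaquetteTop_of_countTop` and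
  `|C₀ + A·log γ⁻¹| ≤ |C₀| + A·log γ⁻¹`, `e^{9000L³A·log γ⁻¹} = γ^{−9000L³A}` — i.e. g22's `unitPolyTail_of_unitLargeFieldCountLog` stopped BEFORE the
  absorption `exp_neg_pFun_sq_le_pow`.  Corollaries `topTailDegraded_of_unitLargeFieldCount` (S1_top = skeleton v9's EDGE stub of 25301 ⇒ organ) and
  ★ `topTailDegraded_of_cappedCoarseStiffnessL` (rev 0's crux stmt-QuantumFields-25301 ⇒ organ).
* §2 ★ `topTailDegraded_of_intCoreRecRows` — the χ-lane's record-free interior socket at every odd `L > 1` ⇒ organ with the record's `(b₀, p₀)`,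
  `c = min c_rec (1/24)`, the record's `κ`, `q = 2 + 3r₀ < 2p₀ = 4r₀ + 2`, `A = 0`, `C = e^{9000L³|log 2|}`: heights `K ≥ 1` by g22's VOLUME-FREE
  `CoarseStiffnessTailUnitPolyTailOfChi.perPlaquetteHigh_int_uniform` at the top slice `j = K`, the bare cut-off `K = 0` by `bare_uniformLargeFieldCount_clean`
  + `perPlaquetteTop_of_countTop` (rate `1/24`, whence the `min`); ★ `topTailDegraded_of_laneRecordsV4Chi` — v5p10's single stub `AlphaInputsT3ACv4RecChi`
  (∀ odd `L > 1`) ⇒ organ (`intCoreRecRows_of_laneRecordsV4Chi`).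

Kernel partial order after this file: `{CappedCoarseStiffnessL ⇒ S1_top ⇒ S1_log} ⇒ TopTailDegraded ⇐ {AlphaInputsT3ACv4RecChi ∀ L ⇒ IntCoreRecRows ∀ L}`,
`TopTailDegraded ∧ AbsorbRate ⇒ UnitPolyTailL ⇒ {HistoryTailL 19936, WedgeTailL 27959}` (skeleton + landed glue).

HONEST FRAMING.  Bookkeeping over landed theorems; every hypothesis (S1_log, S1_top, `CappedCoarseStiffnessL`, `IntCoreRecRows`, `AlphaInputsT3ACv4RecChi`)
is an OPEN statement and nothing of [Balaban1985UV3] is proved.  `UnitPolyTailL`, `HistoryTailL` and the rung `YM3TorusSU2` (R3, a RECORD rung, NOT the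
Clay statement) stay OPEN; the Yang–Mills mass gap is not touched.

References: [Balaban1985UV3] T. Bałaban, Commun. Math. Phys. **102** (1985) 255–275 ((5) p.256, (7) p.257, (47) p.267, (71) p.273);
[FrohlichIsraelLiebSimon1978] J. Fröhlich, R. Israel, E. H. Lieb, B. Simon, Commun. Math. Phys. **62** (1978) 1–34 (Thm 4.1).
-/

set_option autoImplicit false

noncomputable section

namespace Summit.QuantumFields.YangMills.Theorems.CoarseStiffnessTailUnitPolyTailLTopTailSuppliers

open MeasureTheory
open Literature.MathematicalPhysics.QuantumFieldTheory.Balaban1983to89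
open Literature.MathematicalPhysics.QuantumFieldTheory.Balaban1983to89.T3ContinuumYM3Torus
open Literature.MathematicalPhysics.QuantumFieldTheory.Balaban1983to89.T3UnitScaleTilt
open Literature.MathematicalPhysics.QuantumFieldTheory.Balaban1983to89.T3UnitLawDensityEML
open Summit.QuantumFields.Balaban3D.Carriers (suGroupModel)
open Summit.QuantumFields.Balaban3D.Proofs.Primitives (AlphaConsts)
open Summit.QuantumFields.YangMills.Theorems.CoarseStiffnessTailBareUniformCount (bare_uniformLargeFieldCount_clean)
open Summit.QuantumFields.YangMills.Theorems.CoarseStiffnessTailUnitPolyTailOfCount (perPlaquetteTop_of_countTop)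
open Summit.QuantumFields.YangMills.Theorems.CoarseStiffnessTailUnitCountLogSlack
  (unitLargeFieldCountLog_of_unitLargeFieldCount unitLargeFieldCountLog_of_cappedCoarseStiffnessL)
open Summit.QuantumFields.YangMills.Theorems.CoarseStiffnessTailUnitPolyTailOfChi (perPlaquetteHigh_int_uniform)
open Summit.QuantumFields.YangMills.Theorems.HistoryTailLaneTailV4Chi (intCoreRecRows_of_laneRecordsV4Chi)

/-! ## §1 The reflection-positivity suppliers: S1_log, S1_top, the rev-0 crux -/

/-- **S1_log ⇒ the organ** (`κ = 0`, `q = 0`, `A = 9000L³·A_log`, `C = e^{9000L³|C₀|}`, `c = c₀`, profile `(max b₁ 1, max p₁ 3)`): the count bound with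
logarithmic slack at the top slice gives, by the chessboard `perPlaquetteTop_of_countTop` (`t = c₀·p(√γ)²`, `C₁ = C₀ + A·log γ⁻¹`), the single-plaquette
tail `≤ e^{9000L³|C₀|}·γ^{−9000L³A}·e^{−c₀·p(√γ)²}` — the degraded-Gaussian format with no collar term.  Conditional; both sides OPEN.
[cite: Balaban1985UV3, (7) p.257 and (71) p.273; FrohlichIsraelLiebSimon1978, Thm 4.1] -/
theorem topTailDegraded_of_unitLargeFieldCountLog
    (h : ∀ (L : ℕ) (b₀ p₀ : ℝ), 0 < b₀ → 2 < p₀ → ∃ (c₀ C₀ γ₁ : ℝ) (A : ℕ), 0 < c₀ ∧ 0 < γ₁ ∧ γ₁ ≤ 1 ∧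
      ∀ (F : T3Family) (γ : ℝ), F.L = L → 0 < γ → γ ≤ γ₁ → ∀ (K : ℕ),
        ∫ U, Real.exp (c₀ * B10.pFun b₀ p₀ (Real.sqrt γ) ^ 2 *
            ∑ a : Plaq (F.P K) K, (if θBal F.L γ b₀ p₀ 0 ≤ GaugeGroup.dist1 (GaugeField.plaqHol
              (Averaging.iter (fun i => BlockAveraging.blockAvg (P := F.P K) (j := i) ℰp) K U) a)
              then (1 : ℝ) else 0)) ∂(gibbsK F ℰp γ K) ≤
          Real.exp ((C₀ + A * Real.log γ⁻¹) * (Fintype.card (Plaq (F.P K) K) : ℝ))) :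
    ∀ (L : ℕ) (b₁ p₁ : ℝ), ∃ (b₀ p₀ : ℝ), b₁ ≤ b₀ ∧ p₁ ≤ p₀ ∧ 0 < b₀ ∧ 2 < p₀ ∧
        ∃ (c κ q A C γ₁ : ℝ), 0 < c ∧ 0 ≤ κ ∧ q < 2 * p₀ ∧ 0 ≤ C ∧ 0 < γ₁ ∧ γ₁ ≤ 1 ∧
          ∀ (F : T3Family) (γ : ℝ), F.L = L → 0 < γ → γ ≤ γ₁ → ∀ (K : ℕ) (a : Plaq (F.P K) K),
            (gibbsK F ℰp γ K).real
                {U | θBal F.L γ b₀ p₀ 0 ≤ GaugeGroup.dist1 (GaugeField.plaqHol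
                  (Averaging.iter (fun i => BlockAveraging.blockAvg (P := F.P K) (j := i) ℰp) K U) a)} ≤
              C * γ ^ (-A) * Real.exp (-(c * B10.pFun b₀ p₀ (Real.sqrt γ) ^ 2) + κ * (1 + Real.log (Real.sqrt γ)⁻¹) ^ q) := by
  intro L b₁ p₁
  have hb₀ : 0 < max b₁ 1 := lt_of_lt_of_le one_pos (le_max_right _ _)
  have hp₀ : 2 < max p₁ 3 := lt_of_lt_of_le (by norm_num) (le_max_right _ _)
  obtain ⟨c₀, C₀, γ₁, A, hc₀, hγ₁, hγ₁1, hTop⟩ := h L (max b₁ 1) (max p₁ 3) hb₀ hp₀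
  refine ⟨max b₁ 1, max p₁ 3, le_max_left _ _, le_max_left _ _, hb₀, hp₀, c₀, 0, 0, 9000 * (L : ℝ) ^ 3 * A,
    Real.exp (9000 * (L : ℝ) ^ 3 * |C₀|), γ₁, hc₀, le_rfl, by linarith, (Real.exp_pos _).le, hγ₁, hγ₁1,
    fun F γ hFL hγ hγle K a => ?_⟩
  have hγ1 : γ ≤ 1 := hγle.trans hγ₁1
  have hN := hTop F γ hFL hγ hγle K
  subst hFL
  set t : ℝ := c₀ * B10.pFun (max b₁ 1) (max p₁ 3) (Real.sqrt γ) ^ 2 with htdef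
  have ht : 0 ≤ t := mul_nonneg hc₀.le (sq_nonneg _)
  have htop := perPlaquetteTop_of_countTop F hγ hγ1 ht K hN a
  refine htop.trans ?_
  rw [zero_mul, add_zero]
  refine mul_le_mul_of_nonneg_right ?_ (Real.exp_pos _).le
  -- `|C₀ + A log γ⁻¹| ≤ |C₀| + A log γ⁻¹` and `exp(9000L³·A·log γ⁻¹) = γ^{−9000L³A}`
  have hlog : 0 ≤ Real.log γ⁻¹ := Real.log_nonneg ((one_le_inv₀ hγ).mpr hγ1)
  have habs : |C₀ + A * Real.log γ⁻¹| ≤ |C₀| + A * Real.log γ⁻¹ := by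
    refine (abs_add_le _ _).trans (le_of_eq ?_)
    rw [abs_of_nonneg (mul_nonneg (Nat.cast_nonneg _) hlog)]
  have hpow : Real.exp (9000 * (F.L : ℝ) ^ 3 * (A * Real.log γ⁻¹)) = γ ^ (-(9000 * (F.L : ℝ) ^ 3 * A)) := by
    rw [Real.rpow_def_of_pos hγ, Real.log_inv]
    ring_nf
  calc Real.exp (9000 * (F.L : ℝ) ^ 3 * |C₀ + A * Real.log γ⁻¹|)
      ≤ Real.exp (9000 * (F.L : ℝ) ^ 3 * (|C₀| + A * Real.log γ⁻¹)) :=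
        Real.exp_le_exp.mpr (mul_le_mul_of_nonneg_left habs (by positivity))
    _ = Real.exp (9000 * (F.L : ℝ) ^ 3 * |C₀|) * γ ^ (-(9000 * (F.L : ℝ) ^ 3 * A)) := by
        rw [mul_add, Real.exp_add, hpow]

/-- **S1_top ⇒ the organ**: skeleton v9's registered EDGE stub `stub_unitLargeFieldCount` of crux stmt-QuantumFields-25301 (the uniform unit-scale count
bound, signature verbatim) is S1_log with `A = 0` (g21's `unitLargeFieldCountLog_of_unitLargeFieldCount`), hence §1.  Conditional; both sides OPEN.
[cite: Balaban1985UV3, (71) p.273] -/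
theorem topTailDegraded_of_unitLargeFieldCount
    (h : ∀ (L : ℕ) (b₀ p₀ : ℝ), 0 < b₀ → 2 < p₀ → ∃ (c₀ C₀ γ₁ : ℝ), 0 < c₀ ∧ 0 < γ₁ ∧ γ₁ ≤ 1 ∧
      ∀ (F : T3Family) (γ : ℝ), F.L = L → 0 < γ → γ ≤ γ₁ → ∀ (K : ℕ),
        ∫ U, Real.exp (c₀ * B10.pFun b₀ p₀ (Real.sqrt γ) ^ 2 *
            ∑ a : Plaq (F.P K) K, (if θBal F.L γ b₀ p₀ 0 ≤ GaugeGroup.dist1 (GaugeField.plaqHol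
              (Averaging.iter (fun i => BlockAveraging.blockAvg (P := F.P K) (j := i) ℰp) K U) a)
              then (1 : ℝ) else 0)) ∂(gibbsK F ℰp γ K) ≤
          Real.exp (C₀ * (Fintype.card (Plaq (F.P K) K) : ℝ))) :
    ∀ (L : ℕ) (b₁ p₁ : ℝ), ∃ (b₀ p₀ : ℝ), b₁ ≤ b₀ ∧ p₁ ≤ p₀ ∧ 0 < b₀ ∧ 2 < p₀ ∧
        ∃ (c κ q A C γ₁ : ℝ), 0 < c ∧ 0 ≤ κ ∧ q < 2 * p₀ ∧ 0 ≤ C ∧ 0 < γ₁ ∧ γ₁ ≤ 1 ∧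
          ∀ (F : T3Family) (γ : ℝ), F.L = L → 0 < γ → γ ≤ γ₁ → ∀ (K : ℕ) (a : Plaq (F.P K) K),
            (gibbsK F ℰp γ K).real
                {U | θBal F.L γ b₀ p₀ 0 ≤ GaugeGroup.dist1 (GaugeField.plaqHol
                  (Averaging.iter (fun i => BlockAveraging.blockAvg (P := F.P K) (j := i) ℰp) K U) a)} ≤
              C * γ ^ (-A) * Real.exp (-(c * B10.pFun b₀ p₀ (Real.sqrt γ) ^ 2) + κ * (1 + Real.log (Real.sqrt γ)⁻¹) ^ q) :=
  topTailDegraded_of_unitLargeFieldCountLog (unitLargeFieldCountLog_of_unitLargeFieldCount h)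

/-- ★ **REV 0's CRUX ⇒ THE ORGAN**: `CappedCoarseStiffnessL` (stmt-QuantumFields-25301) ⇒ S1_log (g21's `unitLargeFieldCountLog_of_cappedCoarseStiffnessL`)
⇒ `stub_topTailDegraded`'s statement.  With the landed `stub_absorbRate` and the skeleton's `UnitPolyTailL_of` this re-proves the glue
`UnitPolyTailOfStiffness` (stmt-QuantumFields-24030, ✓) THROUGH the organ.  Conditional; both sides OPEN. [cite: Balaban1985UV3, (71) p.273] -/
theorem topTailDegraded_of_cappedCoarseStiffnessL
    (h : Summit.QuantumFields.YangMills.Theses.CoarseStiffnessTail.CappedCoarseStiffnessL) :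
    ∀ (L : ℕ) (b₁ p₁ : ℝ), ∃ (b₀ p₀ : ℝ), b₁ ≤ b₀ ∧ p₁ ≤ p₀ ∧ 0 < b₀ ∧ 2 < p₀ ∧
        ∃ (c κ q A C γ₁ : ℝ), 0 < c ∧ 0 ≤ κ ∧ q < 2 * p₀ ∧ 0 ≤ C ∧ 0 < γ₁ ∧ γ₁ ≤ 1 ∧
          ∀ (F : T3Family) (γ : ℝ), F.L = L → 0 < γ → γ ≤ γ₁ → ∀ (K : ℕ) (a : Plaq (F.P K) K),
            (gibbsK F ℰp γ K).real
                {U | θBal F.L γ b₀ p₀ 0 ≤ GaugeGroup.dist1 (GaugeField.plaqHol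
                  (Averaging.iter (fun i => BlockAveraging.blockAvg (P := F.P K) (j := i) ℰp) K U) a)} ≤
              C * γ ^ (-A) * Real.exp (-(c * B10.pFun b₀ p₀ (Real.sqrt γ) ^ 2) + κ * (1 + Real.log (Real.sqrt γ)⁻¹) ^ q) :=
  topTailDegraded_of_unitLargeFieldCountLog (unitLargeFieldCountLog_of_cappedCoarseStiffnessL h)

/-! ## §2 The renormalisation-group supplier: the χ-lane's interior socket, hence v5p10's single stub -/

/-- ★ **THE χ-LANE's INTERIOR SOCKET AT EVERY ODD `L > 1` ⇒ THE ORGAN** (profile = the record's `(b₀, p₀)`, `c = min c_rec (1/24)`, the record's `κ`,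
`q = 2 + 3r₀ < 2p₀`, `A = 0`, `C = e^{9000L³|log 2|}`): heights `K ≥ 1` are the top slice `j = K` of g22's volume-free
`perPlaquetteHigh_int_uniform` (`≤ exp(−c·p(√γ)² + κ·(1 + log(√γ)⁻¹)^{2+3r₀})`), the bare cut-off `K = 0` is `bare_uniformLargeFieldCount_clean` through the
top-slice chessboard (`≤ e^{9000L³|log 2|}·e^{−p(√γ)²/24}`); block sizes with no family are vacuous.  Conditional on the socket; nothing of
[Balaban1985UV3] is proved. [cite: Balaban1985UV3, (5) p.256, (47) p.267 and (71) p.273; FrohlichIsraelLiebSimon1978, Thm 4.1] -/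
theorem topTailDegraded_of_intCoreRecRows (hrec : ∀ L : ℕ, Odd L → 1 < L → AlphaInputsT3AC.IntCoreRecRows L) :
    ∀ (L : ℕ) (b₁ p₁ : ℝ), ∃ (b₀ p₀ : ℝ), b₁ ≤ b₀ ∧ p₁ ≤ p₀ ∧ 0 < b₀ ∧ 2 < p₀ ∧
        ∃ (c κ q A C γ₁ : ℝ), 0 < c ∧ 0 ≤ κ ∧ q < 2 * p₀ ∧ 0 ≤ C ∧ 0 < γ₁ ∧ γ₁ ≤ 1 ∧
          ∀ (F : T3Family) (γ : ℝ), F.L = L → 0 < γ → γ ≤ γ₁ → ∀ (K : ℕ) (a : Plaq (F.P K) K),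
            (gibbsK F ℰp γ K).real
                {U | θBal F.L γ b₀ p₀ 0 ≤ GaugeGroup.dist1 (GaugeField.plaqHol
                  (Averaging.iter (fun i => BlockAveraging.blockAvg (P := F.P K) (j := i) ℰp) K U) a)} ≤
              C * γ ^ (-A) * Real.exp (-(c * B10.pFun b₀ p₀ (Real.sqrt γ) ^ 2) + κ * (1 + Real.log (Real.sqrt γ)⁻¹) ^ q) := by
  intro L b₁ p₁
  by_cases hLL : Odd L ∧ 1 < L
  swap
  · -- no three-torus family has this block size: vacuous
    refine ⟨max b₁ 1, max p₁ 3, le_max_left _ _, le_max_left _ _, lt_of_lt_of_le one_pos (le_max_right _ _),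
      lt_of_lt_of_le (by norm_num) (le_max_right _ _), 1, 0, 0, 0, 0, 1, one_pos, le_rfl,
      lt_of_lt_of_le (by norm_num) (mul_le_mul_of_nonneg_left (le_max_right p₁ 3) zero_le_two), le_rfl, one_pos, le_rfl,
      fun F γ hFL _ _ K a => absurd ?_ hLL⟩
    exact hFL ▸ F.hL
  obtain ⟨hLo, hL⟩ := hLL
  obtain ⟨b₁', p₁', hrec'⟩ := hrec L hLo hL
  obtain ⟨𝔠, a₁, hcb, hcp, ha1, h𝔠⟩ := hrec' (max b₁ b₁') (max p₁ p₁') (le_max_right _ _) (le_max_right _ _)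
  obtain ⟨κ, γ₁, c, hκ, hγ₁, hγ₁1, hc0, -, hhigh⟩ := perPlaquetteHigh_int_uniform L hLo hL 𝔠 a₁ ha1 h𝔠
  have hq : 2 + 3 * 𝔠.r₀ < 2 * 𝔠.p₀ := by
    have := 𝔠.one_le_r₀
    show 2 + 3 * 𝔠.r₀ < 2 * (2 * 𝔠.r₀ + 1)
    linarith
  -- the bare cut-off `K = 0`
  obtain ⟨γb, hγb, hγb1, hbare⟩ := bare_uniformLargeFieldCount_clean (p₀ := 𝔠.p₀) 𝔠.b₀_pos (by linarith [𝔠.two_lt_p₀])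
  have hc' : 0 < min c (1 / 24) := lt_min hc0 (by norm_num)
  have hC1 : (1 : ℝ) ≤ Real.exp (9000 * (L : ℝ) ^ 3 * |Real.log 2|) := Real.one_le_exp (by positivity)
  refine ⟨𝔠.b₀, 𝔠.p₀, hcb ▸ le_max_left _ _, hcp ▸ le_max_left _ _, 𝔠.b₀_pos, 𝔠.two_lt_p₀, min c (1 / 24), κ, 2 + 3 * 𝔠.r₀, 0,
    Real.exp (9000 * (L : ℝ) ^ 3 * |Real.log 2|), min γ₁ γb, hc', hκ, hq, (Real.exp_pos _).le, lt_min hγ₁ hγb,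
    (min_le_left _ _).trans hγ₁1, fun F γ hFL hγ hγle K a => ?_⟩
  have hγγ₁ : γ ≤ γ₁ := hγle.trans (min_le_left _ _)
  have hγγb : γ ≤ γb := hγle.trans (min_le_right _ _)
  have hγ1 : γ ≤ 1 := hγγ₁.trans hγ₁1
  subst hFL
  rw [neg_zero, Real.rpow_zero, mul_one]
  -- the collar term is nonnegative and the rate `min c (1/24)` is below both suppliers' rates
  set x : ℝ := 1 + Real.log (Real.sqrt γ)⁻¹ with hxdef
  have hx1 : 1 ≤ x := by
    have hs1 : Real.sqrt γ ≤ 1 := Real.sqrt_le_one.mpr hγ1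
    have hs0 : 0 < Real.sqrt γ := Real.sqrt_pos.mpr hγ
    have : 0 ≤ Real.log (Real.sqrt γ)⁻¹ := Real.log_nonneg ((one_le_inv₀ hs0).mpr hs1)
    rw [hxdef]; linarith
  have hxq : 0 ≤ κ * x ^ (2 + 3 * 𝔠.r₀) := mul_nonneg hκ (Real.rpow_nonneg (zero_le_one.trans hx1) _)
  have hp2 : 0 ≤ B10.pFun 𝔠.b₀ 𝔠.p₀ (Real.sqrt γ) ^ 2 := sq_nonneg _
  rcases Nat.eq_zero_or_pos K with hK | hK
  · -- `K = 0`: the bare torus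
    subst hK
    have hN := hbare F γ hγ hγγb 0
    rw [pow_zero, mul_one] at hN
    have htop := perPlaquetteTop_of_countTop F hγ hγ1 (θ := θBal F.L γ 𝔠.b₀ 𝔠.p₀ 0)
      (t := (1 / 24) * B10.pFun 𝔠.b₀ 𝔠.p₀ (Real.sqrt γ) ^ 2) (C₁ := Real.log 2) (by positivity) 0 hN a
    refine htop.trans (mul_le_mul_of_nonneg_left (Real.exp_le_exp.mpr ?_) (Real.exp_pos _).le)
    have hmin : min c (1 / 24) * B10.pFun 𝔠.b₀ 𝔠.p₀ (Real.sqrt γ) ^ 2 ≤ (1 / 24) * B10.pFun 𝔠.b₀ 𝔠.p₀ (Real.sqrt γ) ^ 2 :=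
      mul_le_mul_of_nonneg_right (min_le_right _ _) hp2
    linarith
  · -- `K ≥ 1`: the top slice `j = K` of the volume-free (α)-record chain
    have hh := hhigh F γ rfl hγ hγγ₁ K K hK le_rfl a
    rw [Nat.sub_self, pow_zero, mul_one] at hh
    refine hh.trans ?_
    have hmin : min c (1 / 24) * B10.pFun 𝔠.b₀ 𝔠.p₀ (Real.sqrt γ) ^ 2 ≤ c * B10.pFun 𝔠.b₀ 𝔠.p₀ (Real.sqrt γ) ^ 2 :=
      mul_le_mul_of_nonneg_right (min_le_left _ _) hp2
    calc Real.exp (-(c * B10.pFun 𝔠.b₀ 𝔠.p₀ (Real.sqrt γ) ^ 2) + κ * x ^ (2 + 3 * 𝔠.r₀))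
        ≤ Real.exp (-(min c (1 / 24) * B10.pFun 𝔠.b₀ 𝔠.p₀ (Real.sqrt γ) ^ 2) + κ * x ^ (2 + 3 * 𝔠.r₀)) :=
          Real.exp_le_exp.mpr (by linarith)
      _ = 1 * Real.exp (-(min c (1 / 24) * B10.pFun 𝔠.b₀ 𝔠.p₀ (Real.sqrt γ) ^ 2) + κ * x ^ (2 + 3 * 𝔠.r₀)) := (one_mul _).symm
      _ ≤ Real.exp (9000 * (F.L : ℝ) ^ 3 * |Real.log 2|) *
            Real.exp (-(min c (1 / 24) * B10.pFun 𝔠.b₀ 𝔠.p₀ (Real.sqrt γ) ^ 2) + κ * x ^ (2 + 3 * 𝔠.r₀)) :=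
          mul_le_mul_of_nonneg_right hC1 (Real.exp_pos _).le

/-- ★ **v5p10's SINGLE STUB ⇒ THE ORGAN**: `AlphaInputsT3ACv4RecChi L` for every odd `L > 1` (the χ-lane's version-4 END theorem = the registered stub
`stub_laneRecordsV4Chi` of crux stmt-QuantumFields-19936's line v5p10) instantiates the socket (`intCoreRecRows_of_laneRecordsV4Chi`), hence §2: LINE 20's organ
`stub_topTailDegraded` is DOWNSTREAM of the χ-lane — no separate siege.  Conditional; both sides OPEN.
[cite: Balaban1985UV3, (47) p.267 and (71) p.273; Balaban1985Variational, Thm 1 (8) p.279] -/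
theorem topTailDegraded_of_laneRecordsV4Chi (hrec : ∀ L : ℕ, Odd L → 1 < L → AlphaInputsT3ACv4RecChi L) :
    ∀ (L : ℕ) (b₁ p₁ : ℝ), ∃ (b₀ p₀ : ℝ), b₁ ≤ b₀ ∧ p₁ ≤ p₀ ∧ 0 < b₀ ∧ 2 < p₀ ∧
        ∃ (c κ q A C γ₁ : ℝ), 0 < c ∧ 0 ≤ κ ∧ q < 2 * p₀ ∧ 0 ≤ C ∧ 0 < γ₁ ∧ γ₁ ≤ 1 ∧
          ∀ (F : T3Family) (γ : ℝ), F.L = L → 0 < γ → γ ≤ γ₁ → ∀ (K : ℕ) (a : Plaq (F.P K) K),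
            (gibbsK F ℰp γ K).real
                {U | θBal F.L γ b₀ p₀ 0 ≤ GaugeGroup.dist1 (GaugeField.plaqHol
                  (Averaging.iter (fun i => BlockAveraging.blockAvg (P := F.P K) (j := i) ℰp) K U) a)} ≤
              C * γ ^ (-A) * Real.exp (-(c * B10.pFun b₀ p₀ (Real.sqrt γ) ^ 2) + κ * (1 + Real.log (Real.sqrt γ)⁻¹) ^ q) :=
  topTailDegraded_of_intCoreRecRows fun L hLo hL => intCoreRecRows_of_laneRecordsV4Chi L (hrec L hLo hL)

/-! ## §3 The EVENTUAL organ of the reshaped skeleton (v4, `stub_topTailDegradedEv`: `∃ K₀ ∀ K > K₀`) — appended, g23 -/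

/-- The reshaped skeleton's organ `stub_topTailDegradedEv` (registered on stmt-QuantumFields-24027, 2026-08-29T03:09Z: the degraded-Gaussian top-slice
tail only EVENTUALLY in the cut-off, `∃ K₀ ∀ K > K₀`, the bounded range `K ≤ K₀` being the landed `stub_boundedCutoff`) is WEAKER than the all-`K` organ
of §§1–2: take `K₀ = 0`. [folklore] -/
theorem topTailDegradedEv_of_topTailDegraded
    (h : ∀ (L : ℕ) (b₁ p₁ : ℝ), ∃ (b₀ p₀ : ℝ), b₁ ≤ b₀ ∧ p₁ ≤ p₀ ∧ 0 < b₀ ∧ 2 < p₀ ∧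
        ∃ (c κ q A C γ₁ : ℝ), 0 < c ∧ 0 ≤ κ ∧ q < 2 * p₀ ∧ 0 ≤ C ∧ 0 < γ₁ ∧ γ₁ ≤ 1 ∧
          ∀ (F : T3Family) (γ : ℝ), F.L = L → 0 < γ → γ ≤ γ₁ → ∀ (K : ℕ) (a : Plaq (F.P K) K),
            (gibbsK F ℰp γ K).real
                {U | θBal F.L γ b₀ p₀ 0 ≤ GaugeGroup.dist1 (GaugeField.plaqHol
                  (Averaging.iter (fun i => BlockAveraging.blockAvg (P := F.P K) (j := i) ℰp) K U) a)} ≤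
              C * γ ^ (-A) * Real.exp (-(c * B10.pFun b₀ p₀ (Real.sqrt γ) ^ 2) + κ * (1 + Real.log (Real.sqrt γ)⁻¹) ^ q)) :
    ∀ (L : ℕ) (b₁ p₁ : ℝ), ∃ (b₀ p₀ : ℝ), b₁ ≤ b₀ ∧ p₁ ≤ p₀ ∧ 0 < b₀ ∧ 2 < p₀ ∧
        ∃ (K₀ : ℕ) (c κ q A C γ₁ : ℝ), 0 < c ∧ 0 ≤ κ ∧ q < 2 * p₀ ∧ 0 ≤ C ∧ 0 < γ₁ ∧ γ₁ ≤ 1 ∧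
          ∀ (F : T3Family) (γ : ℝ), F.L = L → 0 < γ → γ ≤ γ₁ → ∀ (K : ℕ), K₀ < K → ∀ (a : Plaq (F.P K) K),
            (gibbsK F ℰp γ K).real
                {U | θBal F.L γ b₀ p₀ 0 ≤ GaugeGroup.dist1 (GaugeField.plaqHol
                  (Averaging.iter (fun i => BlockAveraging.blockAvg (P := F.P K) (j := i) ℰp) K U) a)} ≤
              C * γ ^ (-A) * Real.exp (-(c * B10.pFun b₀ p₀ (Real.sqrt γ) ^ 2) + κ * (1 + Real.log (Real.sqrt γ)⁻¹) ^ q) := by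
  intro L b₁ p₁
  obtain ⟨b₀, p₀, hb₁, hp₁, hb₀, hp₀, c, κ, q, A, C, γ₁, hc, hκ, hq, hC, hγ₁, hγ₁1, hT⟩ := h L b₁ p₁
  exact ⟨b₀, p₀, hb₁, hp₁, hb₀, hp₀, 0, c, κ, q, A, C, γ₁, hc, hκ, hq, hC, hγ₁, hγ₁1,
    fun F γ hFL hγ hγle K _ a => hT F γ hFL hγ hγle K a⟩

/-- ★ **REV 0's CRUX ⇒ THE REGISTERED EVENTUAL ORGAN**: `CappedCoarseStiffnessL` (stmt-QuantumFields-25301) ⇒ `stub_topTailDegradedEv`'s statement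
(verbatim), by §1 and `K₀ = 0`.  Conditional; both sides OPEN. [cite: Balaban1985UV3, (71) p.273] -/
theorem topTailDegradedEv_of_cappedCoarseStiffnessL
    (h : Summit.QuantumFields.YangMills.Theses.CoarseStiffnessTail.CappedCoarseStiffnessL) :
    ∀ (L : ℕ) (b₁ p₁ : ℝ), ∃ (b₀ p₀ : ℝ), b₁ ≤ b₀ ∧ p₁ ≤ p₀ ∧ 0 < b₀ ∧ 2 < p₀ ∧
        ∃ (K₀ : ℕ) (c κ q A C γ₁ : ℝ), 0 < c ∧ 0 ≤ κ ∧ q < 2 * p₀ ∧ 0 ≤ C ∧ 0 < γ₁ ∧ γ₁ ≤ 1 ∧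
          ∀ (F : T3Family) (γ : ℝ), F.L = L → 0 < γ → γ ≤ γ₁ → ∀ (K : ℕ), K₀ < K → ∀ (a : Plaq (F.P K) K),
            (gibbsK F ℰp γ K).real
                {U | θBal F.L γ b₀ p₀ 0 ≤ GaugeGroup.dist1 (GaugeField.plaqHol
                  (Averaging.iter (fun i => BlockAveraging.blockAvg (P := F.P K) (j := i) ℰp) K U) a)} ≤
              C * γ ^ (-A) * Real.exp (-(c * B10.pFun b₀ p₀ (Real.sqrt γ) ^ 2) + κ * (1 + Real.log (Real.sqrt γ)⁻¹) ^ q) :=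
  topTailDegradedEv_of_topTailDegraded (topTailDegraded_of_cappedCoarseStiffnessL h)

/-- ★ **v5p10's SINGLE STUB ⇒ THE REGISTERED EVENTUAL ORGAN**: `AlphaInputsT3ACv4RecChi L` for every odd `L > 1` ⇒ `stub_topTailDegradedEv`'s statement
(verbatim), by §2 and `K₀ = 0` — LINE 20's only open stub is downstream of the χ-lane.  Conditional; both sides OPEN.
[cite: Balaban1985UV3, (47) p.267 and (71) p.273; Balaban1985Variational, Thm 1 (8) p.279] -/
theorem topTailDegradedEv_of_laneRecordsV4Chi (hrec : ∀ L : ℕ, Odd L → 1 < L → AlphaInputsT3ACv4RecChi L) :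
    ∀ (L : ℕ) (b₁ p₁ : ℝ), ∃ (b₀ p₀ : ℝ), b₁ ≤ b₀ ∧ p₁ ≤ p₀ ∧ 0 < b₀ ∧ 2 < p₀ ∧
        ∃ (K₀ : ℕ) (c κ q A C γ₁ : ℝ), 0 < c ∧ 0 ≤ κ ∧ q < 2 * p₀ ∧ 0 ≤ C ∧ 0 < γ₁ ∧ γ₁ ≤ 1 ∧
          ∀ (F : T3Family) (γ : ℝ), F.L = L → 0 < γ → γ ≤ γ₁ → ∀ (K : ℕ), K₀ < K → ∀ (a : Plaq (F.P K) K),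
            (gibbsK F ℰp γ K).real
                {U | θBal F.L γ b₀ p₀ 0 ≤ GaugeGroup.dist1 (GaugeField.plaqHol
                  (Averaging.iter (fun i => BlockAveraging.blockAvg (P := F.P K) (j := i) ℰp) K U) a)} ≤
              C * γ ^ (-A) * Real.exp (-(c * B10.pFun b₀ p₀ (Real.sqrt γ) ^ 2) + κ * (1 + Real.log (Real.sqrt γ)⁻¹) ^ q) :=
  topTailDegradedEv_of_topTailDegraded (topTailDegraded_of_laneRecordsV4Chi hrec)

end Summit.QuantumFields.YangMills.Theorems.CoarseStiffnessTailUnitPolyTailLTopTailSuppliers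

end
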